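/-
Origin: expansion seat `planner-pub-hodgecm-pv03-g7-0`, handover #1 v2 2026-08-18T13:00:52Z (md5 1feb9604) (`HOME/pub-hodgecm-pv03-g7/lean/Pv03g7/GysinMap.lean`, md5 1feb9604, 271 lines);
landed by the gen-8 packager in gate run 30 as `HodgeCM/Model/ToyG2/GysinMap.lean` (verbatim).
-/
/-
pub-hodgecm cell (HodgeCMPerL) — DAG-node prover #03, generation 7 (`planner-pub-hodgecm-pv03-g7-0`, unit `pub-hodgecm-pv03-g7`).
WIP module `Pv03g7.GysinMap`; intended tree module `HodgeCM.Model.ToyG2.GysinMap` (kind L5: toy model / consistency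
witness infrastructure).  Imports only LANDED tree modules.  Nothing is cited; Lean + Mathlib axioms only.

# The block contraction ("integration along the second block") on exterior powers

For linear maps `ψ₁ : V → W₁`, `ψ₂ : V → W₂` (think: the coordinate restrictions of `H¹(Y × Y') = H¹(Y) ⊕ H¹(Y')` to the
two blocks) and a functional `τ : ⋀^d W₂ → R` (think: the trace of `Y'` in its top degree `d = 2 dim Y'`), the **block
contraction**

  `contr k d ψ₁ ψ₂ τ : ⋀^{k+d} V → ⋀^k W₁`,  `v₁ ∧ … ∧ v_{k+d} ↦ Σ_{(k,d)-shuffles σ} sgn σ · τ(ψ₂ v_{σ(k+1)} ∧ … ∧ ψ₂ v_{σ(k+d)}) ·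
      ψ₁ v_{σ(1)} ∧ … ∧ ψ₁ v_{σ(k)}`

(`contrAlt` = the alternating map, a `domCoprod` of `⋀^k ψ₁` with `τ ∘ ⋀^d ψ₂`).  This file proves the three properties
that make it a GYSIN MAP for the block projections in the gen-3 toy universe (`HodgeCM.Model.ToyG2.Gysin3`):

* §1 `contrAlt_append`, **`contr_wedge_map`** — the PROJECTION FORMULA `contr (⋀^k p_A e ∧ ⋀^d p_B ω) = τ ω · e` whenever
  `ψ₁ ∘ p_A = id`, `ψ₁ ∘ p_B = 0`, `ψ₂ ∘ p_B = id` (only the trivial shuffle survives);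
* §2 **`theta_contr_baseChange`** — the contraction commutes with the base change `Θ : ℂ ⊗ ⋀^•_ℚ ≃ ⋀^•_ℂ (ℂ ⊗ ·)` when `τ`
  is replaced by a complexification `τ₂` agreeing with `τ` on rational pure wedges;
* §3 **`contr_map_FF_le`**, **`theta_contr_mem_FF`** — HODGE LEVEL: for toy objects `X, Y₁, Y₂` and Hodge maps `ψ₁, ψ₂`
  (`F¹ ↦ F¹`), if `dim_ℂ F¹(Y₂) ≤ d'` then the complexified contraction maps the eigen-filtration
  `FF^{q+d'}(⋀^{k+d} X)` into `FF^q(⋀^k Y₁)`: in each shuffle term either `> d'` holomorphic eigenvectors land in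
  `F¹(Y₂)` (so their `d`-fold wedge vanishes by linear dependence), or `≥ q` of them land in the `Y₁`-part
  (`Obj.ιMulti_mem_FF`).  Also `finrank_F1_eq_nhol : dim_ℂ F¹(X) = #{holomorphic eigen-indices}`.
-/
import Mathlib
import Summits.HodgeConjecture.HodgeCM.Model.ToyG2.TrTypeProd
import Summits.HodgeConjecture.HodgeCM.Model.ToyG2.EigenForms_2
import Summits.HodgeConjecture.HodgeCM.Model.Toy.StarObj

noncomputable section

open scoped TensorProduct
open exteriorPower HodgeCM.Toy

namespace HodgeCM.ToyG2

namespace BlockGysin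

/-! ### §1 The block contraction over a commutative ring; the projection formula -/

section Algebra

variable {R : Type*} [CommRing R] {V W₁ W₂ : Type*} [AddCommGroup V] [Module R V]
  [AddCommGroup W₁] [Module R W₁] [AddCommGroup W₂] [Module R W₂]
  (k d : ℕ) (ψ₁ : V →ₗ[R] W₁) (ψ₂ : V →ₗ[R] W₂) (τ : (⋀[R]^d W₂) →ₗ[R] R)

/-- the block contraction as an alternating map in `k + d` vectors of `V` -/
def contrAlt : V [⋀^Fin (k + d)]→ₗ[R] (⋀[R]^k W₁) :=
  ((TensorProduct.rid R (⋀[R]^k W₁)).toLinearMap.compAlternatingMap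
    (((ιMulti R k).compLinearMap ψ₁).domCoprod
      ((τ.compAlternatingMap (ιMulti R d)).compLinearMap ψ₂))).domDomCongr finSumFinEquiv

/-- **the block contraction** `⋀^{k+d} V → ⋀^k W₁` -/
def contr : (⋀[R]^(k + d) V) →ₗ[R] (⋀[R]^k W₁) :=
  alternatingMapLinearEquiv (contrAlt k d ψ₁ ψ₂ τ)

/-- (Ported verbatim from the HodgeCMPerL package; no docstring in the source.) -/
theorem contr_ιMulti (u : Fin (k + d) → V) :
    contr k d ψ₁ ψ₂ τ (ιMulti R (k + d) u) = contrAlt k d ψ₁ ψ₂ τ u :=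
  alternatingMapLinearEquiv_apply_ιMulti _ _

/-- (Ported verbatim from the HodgeCMPerL package; no docstring in the source.) -/
theorem contrAlt_apply (u : Fin (k + d) → V) :
    contrAlt k d ψ₁ ψ₂ τ u = TensorProduct.rid R (⋀[R]^k W₁)
      ((((ιMulti R k).compLinearMap ψ₁).domCoprod ((τ.compAlternatingMap (ιMulti R d)).compLinearMap ψ₂))
        (u ∘ finSumFinEquiv)) := rfl

/-- one shuffle term of the block contraction, evaluated -/
theorem rid_summand_mk (σ : Equiv.Perm (Fin k ⊕ Fin d)) (w : Fin k ⊕ Fin d → V) :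
    TensorProduct.rid R (⋀[R]^k W₁) (AlternatingMap.domCoprod.summand ((ιMulti R k).compLinearMap ψ₁)
        ((τ.compAlternatingMap (ιMulti R d)).compLinearMap ψ₂) (Quotient.mk'' σ) w)
      = Equiv.Perm.sign σ • (τ (ιMulti R d fun j => ψ₂ (w (σ (Sum.inr j)))) •
          ιMulti R k fun i => ψ₁ (w (σ (Sum.inl i)))) := by
  rw [domCoprod_summand_mk_apply, Units.smul_def, Units.smul_def, map_zsmul, TensorProduct.rid_tmul]
  rfl

/-- on a concatenated family whose second part is killed by `ψ₁` only the trivial shuffle contributes -/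
theorem contrAlt_append (x : Fin k → V) (y : Fin d → V) (hy : ∀ j, ψ₁ (y j) = 0) :
    contrAlt k d ψ₁ ψ₂ τ (Fin.append x y)
      = τ (ιMulti R d fun j => ψ₂ (y j)) • ιMulti R k fun i => ψ₁ (x i) := by
  have happ : Fin.append x y ∘ finSumFinEquiv = Sum.elim x y := by
    funext u
    rcases u with i | j
    · simp
    · simp
  rw [contrAlt_apply, happ, domCoprod_apply_of_fst_inr_eq_zero _ _ ψ₁ ψ₂ _ (fun j => by simpa using hy j),
    TensorProduct.rid_tmul]
  rfl

variable {k d ψ₁ ψ₂}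

/-- **Projection formula.**  If `ψ₁ ∘ p_A = id`, `ψ₁ ∘ p_B = 0` and `ψ₂ ∘ p_B = id`, then
`contr (⋀^k p_A e ∧ ⋀^d p_B ω) = τ(ω) · e`. -/
theorem contr_wedge_map (pA : W₁ →ₗ[R] V) (pB : W₂ →ₗ[R] V) (h₁ : ψ₁ ∘ₗ pA = LinearMap.id)
    (h₂ : ψ₁ ∘ₗ pB = 0) (h₃ : ψ₂ ∘ₗ pB = LinearMap.id) (e : ⋀[R]^k W₁) (ω : ⋀[R]^d W₂) :
    contr k d ψ₁ ψ₂ τ (wedge R V k d (map k pA e) (map d pB ω)) = τ ω • e := by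
  have e₁ : ∀ w, ψ₁ (pA w) = w := fun w => by simpa using LinearMap.congr_fun h₁ w
  have e₂ : ∀ w, ψ₁ (pB w) = 0 := fun w => by simpa using LinearMap.congr_fun h₂ w
  have e₃ : ∀ w, ψ₂ (pB w) = w := fun w => by simpa using LinearMap.congr_fun h₃ w
  have hgen : ∀ (x : Fin k → W₁) (y : Fin d → W₂),
      contr k d ψ₁ ψ₂ τ (wedge R V k d (map k pA (ιMulti R k x)) (map d pB (ιMulti R d y)))
        = τ (ιMulti R d y) • ιMulti R k x := by
    intro x y
    rw [map_apply_ιMulti, map_apply_ιMulti, BC.wedge_ιMulti, contr_ιMulti,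
      contrAlt_append k d ψ₁ ψ₂ τ (pA ∘ x) (pB ∘ y) (fun j => e₂ (y j))]
    simp only [Function.comp_apply, e₁, e₃]
  -- extend from pure wedges `e = ιMulti x` (for pure `ω`), then from pure `ω`
  have hω : ∀ (y : Fin d → W₂) (e : ⋀[R]^k W₁),
      contr k d ψ₁ ψ₂ τ (wedge R V k d (map k pA e) (map d pB (ιMulti R d y))) = τ (ιMulti R d y) • e := by
    intro y e
    have h := linearMap_ext (R := R) (n := k) (M := W₁)
      (f := contr k d ψ₁ ψ₂ τ ∘ₗ (wedge R V k d).flip (map d pB (ιMulti R d y)) ∘ₗ map k pA)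
      (g := τ (ιMulti R d y) • LinearMap.id) (AlternatingMap.ext fun x => by
        simp only [LinearMap.compAlternatingMap_apply, LinearMap.coe_comp, Function.comp_apply,
          LinearMap.flip_apply, LinearMap.smul_apply, LinearMap.id_apply]
        exact hgen x y)
    simpa only [LinearMap.coe_comp, Function.comp_apply, LinearMap.flip_apply, LinearMap.smul_apply,
      LinearMap.id_apply] using LinearMap.congr_fun h e
  have h := linearMap_ext (R := R) (n := d) (M := W₂)
    (f := contr k d ψ₁ ψ₂ τ ∘ₗ wedge R V k d (map k pA e) ∘ₗ map d pB) (g := τ.smulRight e)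
    (AlternatingMap.ext fun y => by
      simp only [LinearMap.compAlternatingMap_apply, LinearMap.coe_comp, Function.comp_apply,
        LinearMap.smulRight_apply]
      exact hω y e)
  simpa only [LinearMap.coe_comp, Function.comp_apply, LinearMap.smulRight_apply] using LinearMap.congr_fun h ω

end Algebra

/-! ### §2 Base change `ℚ → ℂ` -/

section BaseChange

variable {V W₁ W₂ : Type*} [AddCommGroup V] [Module ℚ V] [AddCommGroup W₁] [Module ℚ W₁]
  [AddCommGroup W₂] [Module ℚ W₂] (k d : ℕ) (ψ₁ : V →ₗ[ℚ] W₁) (ψ₂ : V →ₗ[ℚ] W₂)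
  (τ₁ : (⋀[ℚ]^d W₂) →ₗ[ℚ] ℚ) (τ₂ : (⋀[ℂ]^d (ℂ ⊗[ℚ] W₂)) →ₗ[ℂ] ℂ)
  (hτ : ∀ y : Fin d → W₂, τ₂ (ιMulti ℂ d fun j => (1 : ℂ) ⊗ₜ[ℚ] y j) = (τ₁ (ιMulti ℚ d y) : ℂ))
include hτ

/-- the contraction with a complexified functional extends the rational contraction (on `Θ`) -/
theorem thetaLin_comp_contr :
    BC.thetaLin ℚ ℂ W₁ k ∘ₗ contr k d ψ₁ ψ₂ τ₁
      = (contr k d (ψ₁.baseChange ℂ) (ψ₂.baseChange ℂ) τ₂).restrictScalars ℚ ∘ₗ BC.thetaLin ℚ ℂ V (k + d) := by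
  classical
  refine linearMap_ext (AlternatingMap.ext fun u => ?_)
  simp only [LinearMap.compAlternatingMap_apply, LinearMap.coe_comp, Function.comp_apply,
    LinearMap.coe_restrictScalars, contr_ιMulti, BC.thetaLin_ιMulti]
  rw [contrAlt_apply, contrAlt_apply, domCoprod_apply_eq_sum, domCoprod_apply_eq_sum]
  simp only [map_sum]
  refine Finset.sum_congr rfl fun σ _ => Quotient.inductionOn' σ fun σ => ?_
  rw [rid_summand_mk, rid_summand_mk, Units.smul_def, Units.smul_def, map_zsmul, map_smul,
    BC.thetaLin_ιMulti]
  simp only [Function.comp_apply, LinearMap.baseChange_tmul]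
  rw [hτ (fun j => ψ₂ (u (finSumFinEquiv (σ (Sum.inr j))))), ← IsScalarTower.algebraMap_smul ℂ
    (τ₁ (ιMulti ℚ d fun j => ψ₂ (u (finSumFinEquiv (σ (Sum.inr j)))))), eq_ratCast]

/-- **Base change.**  `Θ ((contr τ₁) ⊗ ℂ) = contr_ℂ τ₂ ∘ Θ`. -/
theorem theta_contr_baseChange (x : ℂ ⊗[ℚ] ⋀[ℚ]^(k + d) V) :
    BC.theta ℚ ℂ W₁ k ((contr k d ψ₁ ψ₂ τ₁).baseChange ℂ x)
      = contr k d (ψ₁.baseChange ℂ) (ψ₂.baseChange ℂ) τ₂ (BC.theta ℚ ℂ V (k + d) x) := by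
  have key := thetaLin_comp_contr k d ψ₁ ψ₂ τ₁ τ₂ hτ
  induction x using TensorProduct.induction_on with
  | zero => simp
  | tmul a y =>
      simp only [LinearMap.baseChange_tmul, BC.theta_tmul, map_smul]
      exact congrArg (a • ·) (LinearMap.congr_fun key y)
  | add x y hx hy => simp [map_add, hx, hy]

end BaseChange

/-! ### §3 Hodge level: the contraction lowers the eigen-filtration step by (at most) the fibre level -/

section Hodge

open HodgeCM.Toy.Obj

/-- `dim_ℂ F¹(X)` is the number of holomorphic eigen-indices. -/
theorem finrank_F1_eq_nhol (X : Obj) : Module.finrank ℂ X.F1 = X.nhol Finset.univ := by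
  classical
  rw [F1_eq_span, Set.image_eq_range, finrank_span_eq_card
    (b := fun s : ({s | X.hol s} : Set X.Idx) => X.eB s) (X.eB.linearIndependent.comp _ Subtype.val_injective),
    nhol_eq, ← Set.toFinset_card, Set.toFinset_setOf]

/-- a wedge of `d` vectors, more than `dim F¹(Y)` of which lie in `F¹(Y)`, vanishes -/
theorem ιMulti_eq_zero_of_finrank_lt (Y : Obj) {d : ℕ} (w : Fin d → Y.LC) (H : Finset (Fin d))
    (hH : ∀ j ∈ H, w j ∈ Y.F1) (hlt : Module.finrank ℂ Y.F1 < H.card) : ιMulti ℂ d w = 0 := by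
  refine AlternatingMap.map_linearDependent _ _ fun hli => ?_
  have h1 : LinearIndependent ℂ (fun j : H => (⟨w j, hH j j.2⟩ : Y.F1)) := by
    apply LinearIndependent.of_comp Y.F1.subtype
    exact hli.comp _ Subtype.val_injective
  have h2 := h1.fintype_card_le_finrank
  rw [Fintype.card_coe] at h2
  omega

/-- holomorphic slots along a permutation -/
theorem cnt_comp_equiv (X : Obj) {n : ℕ} (g : Fin n → X.Idx) (π : Equiv.Perm (Fin n)) :
    X.cnt (g ∘ π) = X.cnt g := by
  classical
  rw [cnt_eq_card_filter, cnt_eq_card_filter]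
  exact Finset.card_equiv π fun j => by simp

/-- the holomorphic slots of `g` split between the two parts of any shuffle -/
theorem cnt_shuffle (X : Obj) {k d : ℕ} (g : Fin (k + d) → X.Idx) (σ : Equiv.Perm (Fin k ⊕ Fin d)) :
    X.cnt (fun i => g (finSumFinEquiv (σ (Sum.inl i)))) + X.cnt (fun j => g (finSumFinEquiv (σ (Sum.inr j))))
      = X.cnt g := by
  rw [← cnt_append]
  have h : Fin.append (fun i => g (finSumFinEquiv (σ (Sum.inl i)))) (fun j => g (finSumFinEquiv (σ (Sum.inr j))))
      = g ∘ (finSumFinEquiv.symm.trans (σ.trans finSumFinEquiv)) := by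
    funext l
    obtain ⟨u, rfl⟩ := finSumFinEquiv.surjective l
    rcases u with i | j
    · simp
    · simp
  rw [h, cnt_comp_equiv]

variable {X Y₁ Y₂ : Obj} {k d : ℕ} {d' : ℕ} (ψ₁ : X.L →ₗ[ℚ] Y₁.L) (ψ₂ : X.L →ₗ[ℚ] Y₂.L)
  (hψ₁ : IsHodge (X := Y₁) (Y := X) ψ₁) (hψ₂ : IsHodge (X := Y₂) (Y := X) ψ₂)
  (τ₂ : (⋀[ℂ]^d Y₂.LC) →ₗ[ℂ] ℂ) (hF : Module.finrank ℂ Y₂.F1 ≤ d')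
include hψ₁ hψ₂ hF

/-- **Hodge level of the complex contraction**: `contr_ℂ (FF^{q+d'} ⋀^{k+d} X) ⊆ FF^q ⋀^k Y₁`. -/
theorem contr_map_FF_le (q : ℤ) :
    (X.FF (k + d) (q + d')).map (contr k d (ψ₁.baseChange ℂ) (ψ₂.baseChange ℂ) τ₂) ≤ Y₁.FF k q := by
  classical
  rw [FF, Submodule.map_span_le]
  rintro _ ⟨g, hg, rfl⟩
  rw [mono_def, contr_ιMulti, contrAlt_apply, domCoprod_apply_eq_sum, map_sum]
  refine Submodule.sum_mem _ fun σ _ => Quotient.inductionOn' σ fun σ => ?_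
  rw [rid_summand_mk, Units.smul_def, ← Int.cast_smul_eq_zsmul ℂ]
  refine Submodule.smul_mem _ _ ?_
  simp only [Function.comp_apply]
  have hF1₁ : ∀ i, X.hol (g (finSumFinEquiv (σ (Sum.inl i)))) →
      ψ₁.baseChange ℂ (X.eB (g (finSumFinEquiv (σ (Sum.inl i))))) ∈ Y₁.F1 :=
    fun i hi => hψ₁ ⟨_, X.eB_mem_F1 hi, rfl⟩
  have hF1₂ : ∀ j, X.hol (g (finSumFinEquiv (σ (Sum.inr j)))) →
      ψ₂.baseChange ℂ (X.eB (g (finSumFinEquiv (σ (Sum.inr j))))) ∈ Y₂.F1 :=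
    fun j hj => hψ₂ ⟨_, X.eB_mem_F1 hj, rfl⟩
  have hcnt := cnt_shuffle X g σ
  by_cases hlt : d' < X.cnt (fun j => g (finSumFinEquiv (σ (Sum.inr j))))
  · -- too many holomorphic vectors in the fibre part: its top wedge vanishes
    have h0 : ιMulti ℂ d (fun j => ψ₂.baseChange ℂ (X.eB (g (finSumFinEquiv (σ (Sum.inr j)))))) = 0 :=
      ιMulti_eq_zero_of_finrank_lt Y₂ _ (X.holSlots fun j => g (finSumFinEquiv (σ (Sum.inr j))))
        (fun j hj => hF1₂ j ((X.mem_holSlots _ j).mp hj)) (lt_of_le_of_lt hF hlt)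
    rw [h0, map_zero, zero_smul]
    exact Submodule.zero_mem _
  · refine Submodule.smul_mem _ _ (Y₁.ιMulti_mem_FF _ q (X.holSlots fun i => g (finSumFinEquiv (σ (Sum.inl i))))
      (fun i hi => hF1₁ i ((X.mem_holSlots _ i).mp hi)) ?_)
    change q ≤ ((X.cnt fun i => g (finSumFinEquiv (σ (Sum.inl i)))) : ℤ)
    have hle := not_lt.mp hlt
    omega

/-- **Hodge level, rational form.**  For a rational functional `τ₁` on `⋀^d H¹(Y₂)` and a class `z ∈ ⋀^{k+d} H¹(X)`
with `Θ(1 ⊗ z) ∈ FF^{q+d'}`, the contraction satisfies `Θ(1 ⊗ contr z) ∈ FF^q`. -/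
theorem theta_contr_mem_FF (τ₁ : (⋀[ℚ]^d Y₂.L) →ₗ[ℚ] ℚ) (q : ℤ) (z : ⋀[ℚ]^(k + d) X.L)
    (hz : X.Θ (k + d) ((1 : ℂ) ⊗ₜ[ℚ] z) ∈ X.FF (k + d) (q + d')) :
    Y₁.Θ k ((1 : ℂ) ⊗ₜ[ℚ] contr k d ψ₁ ψ₂ τ₁ z) ∈ Y₁.FF k q := by
  have hτ : ∀ y : Fin d → Y₂.L,
      baseC Y₂ τ₁ (ιMulti ℂ d fun j => (1 : ℂ) ⊗ₜ[ℚ] y j) = (τ₁ (ιMulti ℚ d y) : ℂ) :=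
    fun y => baseCA_tmul Y₂ τ₁ y
  have h1 : (1 : ℂ) ⊗ₜ[ℚ] contr k d ψ₁ ψ₂ τ₁ z = (contr k d ψ₁ ψ₂ τ₁).baseChange ℂ ((1 : ℂ) ⊗ₜ[ℚ] z) := by
    rw [LinearMap.baseChange_tmul]
  rw [h1, BC.thetaEquiv_apply, theta_contr_baseChange k d ψ₁ ψ₂ τ₁ (baseC Y₂ τ₁) hτ]
  exact contr_map_FF_le ψ₁ ψ₂ hψ₁ hψ₂ (baseC Y₂ τ₁) hF q ⟨_, hz, rfl⟩

end Hodge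

end BlockGysin

end HodgeCM.ToyG2

end
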